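import Mathlib
import Summits.HubbardSuperconductivity.HubbardSuperconductivity.Theses.FunctionFieldCertificate
import Summits.HubbardSuperconductivity.HubbardSuperconductivity.Theorems.EnslavedA1gLowerSandwich
import Summits.HubbardSuperconductivity.HubbardSuperconductivity.Theorems.EnslavedA1gPairChemicalPotentialWindow

/-!
# Sketch (crux-ideate round 2, ideator 4) — first lemmas for the crux idea card
`eta-lowest-weight-annihilators` on `FunctionFieldCertificate.MesoscopicPairOrder`
(stmt-HubbardSuperconductivity-7331).

Everything here is a `Prop` (statement only) except the FIRST LEMMA `lowestWeightCriterion_holds`,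
which is PROVED (sorry-free) from tree facts, and a definitional sanity lemma; nothing else is asserted. Objects: Yang's `η`-operators of the tree
(`Literature.MathematicalPhysics.QuantumLattice.etaRaise/etaLower` with the bipartite stagger
`torusStagger`) on the fermionic 2-torus of the route.
-/

noncomputable section

-- the summit namespace repeats the problem name by design (D-0017)
set_option linter.dupNamespace false

namespace Summit.HubbardSuperconductivity.HubbardSuperconductivity.Cruxes.MesoscopicPairOrder.Ideator4

open Matrix Finset
open Literature.MathematicalPhysics.QuantumLattice Literature.Probability.LatticeModels
open Literature.MathematicalPhysics.QuantumLattice.EigenvalueContinuation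
  (re_star_dotProduct_self_nonneg re_star_dotProduct_self_pos)
open scoped BigOperators Matrix ComplexOrder

/-- Yang's `η = Σ_z (-1)^z c_{z↓} c_{z↑}` on the fermionic torus `(ℤ/Lℤ)²` (tree operators). -/
abbrev eta (L : ℕ) :
    Matrix (Finset (Orb (FermionTorus 2 L))) (Finset (Orb (FermionTorus 2 L))) ℂ :=
  etaLower (torusStagger : FermionTorus 2 L → ℤˣ)

/-- `η† = Σ_z (-1)^z c†_{z↑} c†_{z↓}`. -/
abbrev etaDag (L : ℕ) :
    Matrix (Finset (Orb (FermionTorus 2 L))) (Finset (Orb (FermionTorus 2 L))) ℂ :=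
  etaRaise (torusStagger : FermionTorus 2 L → ℤˣ)

/-- The route's electron number `N_L = 2⌊(1-δ)L²/2⌋`. -/
abbrev pairNumber (δ : ℝ) (L : ℕ) : ℕ := 2 * ⌊(1 - δ) * (L : ℝ) ^ 2 / 2⌋₊

/-- **(L1) Pseudospin Casimir is conserved at EVERY filling.** On the torus of even side the pure
Hubbard Hamiltonian commutes with `η†η` (hence with `J² = η†η + J_z² - J_z`, `J_z = (N̂ - L²)/2`),
for every `U`: `[H, η†η] = [H,η†]η + η†[H,η] = Uη†η - Uη†η = 0` from Yang's `[H, η†] = U η†`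
(tree: `hamiltonian_commutator_etaRaise` / `etaRaise_commutator_holds`). Doping does NOT break the
symmetry; it only fixes `J_z = -δL²/2`. -/
def EtaCasimirConserved : Prop :=
  ∀ (U : ℝ) (L : ℕ), Even L → Commute (hubbardTorus 2 L 1 U) (etaDag L * eta L)

/-- **Proof of (L1)** (two lines of algebra on Yang's commutator and its adjoint). -/
theorem etaCasimirConserved_holds : EtaCasimirConserved := by
  intro U L hL
  set H := hubbardTorus 2 L 1 U with hH
  have hHG : H = hamiltonian (fermionTorusGraph 2 L) 1 U := rfl
  have hcomm := hamiltonian_commutator_etaRaise (fermionTorusGraph 2 L) torusStagger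
    (fun x y h => torusStagger_eq_neg_of_adj_holds hL h) 1 U
  rw [← hHG] at hcomm
  have hHerm : Hᴴ = H := (hamiltonian_isHermitian_and_commute_holds (fermionTorusGraph 2 L) 1 U).1.eq
  have h1 : H * etaRaise torusStagger = (U : ℂ) • etaRaise torusStagger + etaRaise torusStagger * H :=
    sub_eq_iff_eq_add.1 hcomm
  have h2 : etaLower torusStagger * H =
      (U : ℂ) • etaLower torusStagger + H * etaLower (torusStagger : FermionTorus 2 L → ℤˣ) := by
    have := congrArg Matrix.conjTranspose h1
    simpa [Matrix.conjTranspose_mul, Matrix.conjTranspose_add, Matrix.conjTranspose_smul, hHerm,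
      etaLower, Complex.star_def, Complex.conj_ofReal] using this
  have h3 : H * etaLower torusStagger =
      etaLower torusStagger * H - (U : ℂ) • etaLower (torusStagger : FermionTorus 2 L → ℤˣ) := by
    rw [h2]; abel
  show H * (etaDag L * eta L) = etaDag L * eta L * H
  simp only [etaDag, eta]
  rw [← mul_assoc, h1, add_mul, smul_mul_assoc, mul_assoc, h3, mul_sub, mul_smul_comm, ← mul_assoc]
  abel

/-- **(L2) LOWEST-WEIGHT CRITERION (provable now).** If the pair chemical potential of the
`S^z = 0` sectors is STRICTLY below `U`, `E(N+2, 0) < E(N, 0) + U`, then every ground state of the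
sector `(N+2, S^z = 0)` is annihilated by `η` (it is the lowest-weight vector `|j, -j⟩`,
`j = (L² - N - 2)/2`, of its pseudospin multiplet). Proof: `ηψ ∈ szSector N 0`, and
`⟨ηψ, (H - E(N+2,0) + U) ηψ⟩ = ⟨ψ, η†([H,η] + η(H - E(N+2,0)) + Uη)ψ⟩ = 0` by `[H,η] = -Uη`, while
the variational principle gives `⟨ηψ, H ηψ⟩ ≥ E(N,0)‖ηψ‖²`; so `(E(N,0) - E(N+2,0) + U)‖ηψ‖² ≤ 0`. -/
def LowestWeightCriterion : Prop :=
  ∀ (U : ℝ) (L : ℕ) [NeZero L], Even L → ∀ n : ℕ, 2 * n + 2 ≤ L ^ 2 →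
    (hubbardTorus 2 L 1 U).minEnergyOn (szSector (2 * (n + 1)) 0) <
        (hubbardTorus 2 L 1 U).minEnergyOn (szSector (2 * n) 0) + U →
      ∀ ψ : Fock (Orb (FermionTorus 2 L)),
        IsGroundStateInSector (hubbardTorus 2 L 1 U) (2 * (n + 1)) 0 ψ → eta L *ᵥ ψ = 0

/-- **Proof of the first lemma (L2)** from tree facts: Yang's commutator
(`hamiltonian_commutator_etaRaise`, adjoint taken with `hamiltonian_isHermitian_and_commute_holds`),
the sector ladder (`IsInSector.annihilation_up/down_mulVec`, `etaLower_eq_sum_holds`) and the sector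
variational principle (`szSector_groundState`). -/
theorem lowestWeightCriterion_holds : LowestWeightCriterion := by
  intro U L _ hL n hn hgap ψ hgs
  set H := hubbardTorus 2 L 1 U with hH
  have hHG : H = hamiltonian (fermionTorusGraph 2 L) 1 U := rfl
  obtain ⟨hψS, hψ0, hHψ⟩ := hgs
  have hψsec : IsInSector (n + 1) (n + 1) ψ := (mem_szSector_two_mul_zero_iff (n + 1) ψ).1 hψS
  set E₂ : ℝ := H.minEnergyOn (szSector (2 * (n + 1)) 0) with hE₂
  set E₀ : ℝ := H.minEnergyOn (szSector (2 * n) 0) with hE₀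
  set φ : Fock (Orb (FermionTorus 2 L)) := etaLower torusStagger *ᵥ ψ with hφ
  -- (1) `φ = ηψ` lies in the sector `(n, n)`
  have hφsec : IsInSector n n φ := by
    rw [hφ, etaLower_eq_sum_holds, sum_mulVec]
    refine IsInSector.sum fun x _ => ?_
    rw [smul_mulVec, ← mulVec_mulVec]
    exact ((hψsec.annihilation_up_mulVec x).annihilation_down_mulVec x).smul _
  -- (2) Yang's commutator, lowered: `H η = η H - U η`
  have hcomm := hamiltonian_commutator_etaRaise (fermionTorusGraph 2 L) torusStagger
    (fun x y h => torusStagger_eq_neg_of_adj_holds hL h) 1 U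
  rw [← hHG] at hcomm
  have hHerm : Hᴴ = H := (hamiltonian_isHermitian_and_commute_holds (fermionTorusGraph 2 L) 1 U).1.eq
  have h1 : H * etaRaise torusStagger = (U : ℂ) • etaRaise torusStagger + etaRaise torusStagger * H :=
    sub_eq_iff_eq_add.1 hcomm
  have h2 : etaLower torusStagger * H =
      (U : ℂ) • etaLower torusStagger + H * etaLower (torusStagger : FermionTorus 2 L → ℤˣ) := by
    have := congrArg Matrix.conjTranspose h1
    simpa [Matrix.conjTranspose_mul, Matrix.conjTranspose_add, Matrix.conjTranspose_smul, hHerm,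
      etaLower, Complex.star_def, Complex.conj_ofReal] using this
  have h3 : H * etaLower torusStagger =
      etaLower torusStagger * H - (U : ℂ) • etaLower (torusStagger : FermionTorus 2 L → ℤˣ) := by
    rw [h2]; abel
  -- (3) `φ` is an eigenvector with eigenvalue `E₂ - U`
  have hHφ : H *ᵥ φ = ((E₂ - U : ℝ) : ℂ) • φ := by
    show H *ᵥ (etaLower torusStagger *ᵥ ψ) = ((E₂ - U : ℝ) : ℂ) • (etaLower torusStagger *ᵥ ψ)
    rw [mulVec_mulVec, h3, sub_mulVec, smul_mulVec, ← mulVec_mulVec, hHψ, mulVec_smul, ← sub_smul]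
    congr 1
    push_cast
    ring
  have hexp : (expect H φ).re = (E₂ - U) * (star φ ⬝ᵥ φ).re := by
    rw [Literature.MathematicalPhysics.QuantumLattice.expect, hHφ, dotProduct_smul, smul_eq_mul,
      Complex.re_ofReal_mul]
  -- (4) variational principle in the sector `(n, n)`
  have hcard : Fintype.card (FermionTorus 2 L) = L ^ 2 := card_fermionTorus 2 L
  have hn0 : n ≤ Fintype.card (FermionTorus 2 L) := by rw [hcard]; omega
  have hvar := (szSector_groundState (fermionTorusGraph 2 L) 1 U hn0).2 φ hφsec
  rw [← hHG, hexp] at hvar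
  -- (5) conclude: `(E₀ - E₂ + U) ‖φ‖² ≤ 0` with a positive bracket
  by_contra hφ0
  have hpos := re_star_dotProduct_self_pos hφ0
  have hgap' : 0 < E₀ - E₂ + U := by rw [hE₀, hE₂]; linarith
  nlinarith

/-- **(H) The one hypothesis the lever needs at the crux's `(U, δ)`**: strict pair chemical
potential below `U` along large even sides, `E(N_L, 0) < E(N_L - 2, 0) + U`. (The tree proves the
WEAK inequality `E(N+2,0) ≤ E(N,0) + U` for all `N`, route `EnslavedA1g` p-item 0939
`pairChemicalPotentialWindow_proof`; strictness fails iff an `η`-pair state `η†φ` is a sector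
ground state, i.e. iff `η`-pairs condense at zero cost — physically excluded for `U > 0`, `δ > 0`,
unproved in general; PROVED in the corner of (L3) below.) -/
def PairChemicalPotentialBelowU (U δ : ℝ) : Prop :=
  ∃ L₀ : ℕ, ∀ (L : ℕ) [NeZero L], L₀ ≤ L → Even L →
    (hubbardTorus 2 L 1 U).minEnergyOn (szSector (pairNumber δ L) 0) <
      (hubbardTorus 2 L 1 U).minEnergyOn (szSector (pairNumber δ L - 2) 0) + U

/-- **(L3) A provable corner (Euler addition bound, the mirror image of the tree's
`minEnergyOn_pairRemoved_le`).** Adding an electron of spin `τ` to an eigenvector `φ` (`Hφ = Eφ`)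
averaged over all sites, `Σ_z ⟨c†_{zτ}φ, (H - E)c†_{zτ}φ⟩ = -⟨T_τ⟩_φ + U⟨Σ_z n_{zτ̄}(1 - n_{zτ})⟩_φ
≤ (4 + U) N_{τ̄or τ}`-type bounds with `Σ_z ‖c†_{zτ}φ‖² = (L² - N_τ)‖φ‖²`, twice, gives
`E(N+2,0) ≤ E(N,0) + (8n + U(2n+1))/(L² - n)`, `n = N/2`; at density `1 - δ` the increment tends to
`2(1-δ)(4+U)/(1+δ)`, which is `< U` iff `δ > 1/3` and `U > 8(1-δ)/(3δ-1)`. So in that corner every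
sector ground state at the route's density is `η`-lowest-weight, unconditionally. -/
def LowestWeightCorner : Prop :=
  ∀ U δ : ℝ, δ ∈ Set.Ioo (1 / 3 : ℝ) (1 / 2) → 8 * (1 - δ) / (3 * δ - 1) < U →
    PairChemicalPotentialBelowU U δ

/-- **(C1) The consequence the card sells: two-sided ground-state ANNIHILATOR constraints.**
Under (H), for all large even `L`, EVERY normalised `(N_L, 0)`-sector ground state `ψ` and EVERY
matrix `X` (any range, any degree, not sector-preserving), `⟨ψ, X η ψ⟩ = 0` — an infinite family of
linear EQUALITIES valid on ground states only (not on the sector), hence outside the span of the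
certificate generators `O†O`, `Q†[H,Q]` (`Q` sector-preserving), `[H,R]`, `T|_sector = 0` of
`CertifiedSectorLRO`, and usable with free (unsigned) multipliers in any finite-range SOS+KKT
relaxation of the pole-free half. -/
def EtaAnnihilatorConstraints (U δ : ℝ) : Prop :=
  ∃ L₀ : ℕ, ∀ (L : ℕ) [NeZero L], L₀ ≤ L → Even L →
    ∀ ψ : Fock (Orb (FermionTorus 2 L)),
      IsGroundStateInSector (hubbardTorus 2 L 1 U) (pairNumber δ L) 0 ψ →
        ∀ X : Matrix (Finset (Orb (FermionTorus 2 L))) (Finset (Orb (FermionTorus 2 L))) ℂ,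
          star ψ ⬝ᵥ ((X * eta L) *ᵥ ψ) = 0

/-- **(C2) Exact `η`-dressing identity for the crux's own correlators** (polarised Yang
commutator; `[η, P_x] = 0` since both are products of annihilators, and
`‖η†v‖² = ‖ηv‖² + (L² - N + 2)‖v‖²` on `(N-2)`-particle vectors): for an `η`-annihilated `N`-particle
`ψ` and all sites `x, y`,
`(L² - N + 2)·⟨P_xψ, P_yψ⟩ = ⟨η†P_xψ, η†P_yψ⟩` — the `d`-wave pair correlator of the crux equals
`(δL² + 2)⁻¹ ×` the correlator of the NUMBER-CONSERVING composite `η†P_x` ("convert a `d`-wave bond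
pair at `x` into a staggered on-site pair anywhere"); equivalently (Wigner–Eckart for the pseudospin
triplet `(P_x, [η†,P_x]/√2, ·)`, Zhang 1990) `‖P_Bψ‖² = ((j+1)/2)‖Π_⊥[η†, P_B]ψ‖²`, `j = δL²/2`. -/
def EtaDressedPairIdentity : Prop :=
  ∀ (L N : ℕ) [NeZero L] (ψ : Fock (Orb (FermionTorus 2 L))),
    IsNParticle N ψ → eta L *ᵥ ψ = 0 → ∀ x y : TorusSite 2 L,
      (((L : ℂ) ^ 2 - (N : ℂ) + 2) *
          (star (localPair dWaveFormFactor L x *ᵥ ψ) ⬝ᵥ (localPair dWaveFormFactor L y *ᵥ ψ))) =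
        star (etaDag L *ᵥ (localPair dWaveFormFactor L x *ᵥ ψ)) ⬝ᵥ
          (etaDag L *ᵥ (localPair dWaveFormFactor L y *ᵥ ψ))

/-- **(C3) Exact zero of the staggered on-site pair structure factor in every ground state**
(`⟨η†η⟩_ψ = 0` written out): `Σ_{x,y} (-1)^{x+y} ⟨c†_{x↑}c†_{x↓} c_{y↓}c_{y↑}⟩_ψ = 0`, i.e. the
staggered sum of the on-site pair correlation function equals MINUS the doublon density
(`Σ_{r ≠ 0} (-1)^r C_s(r) = -⟨n_↑n_↓⟩`): a sum rule every sector ground state at the crux's `(U,δ)`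
must pass (refuter-usable: it kills e.g. the `vac ⊕ full` box-order witness, `η|full⟩ ≠ 0`). -/
def StaggeredOnsitePairZero (U δ : ℝ) : Prop :=
  ∃ L₀ : ℕ, ∀ (L : ℕ) [NeZero L], L₀ ≤ L → Even L →
    ∀ ψ : Fock (Orb (FermionTorus 2 L)),
      IsGroundStateInSector (hubbardTorus 2 L 1 U) (pairNumber δ L) 0 ψ →
        star (eta L *ᵥ ψ) ⬝ᵥ (eta L *ᵥ ψ) = 0

/-- The chain the card claims (all arrows provable now; (H) is the open input):
`LowestWeightCriterion ∧ PairChemicalPotentialBelowU U δ → EtaAnnihilatorConstraints U δ`. -/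
def CardChain : Prop :=
  LowestWeightCriterion → ∀ U δ : ℝ, PairChemicalPotentialBelowU U δ →
    EtaAnnihilatorConstraints U δ ∧ StaggeredOnsitePairZero U δ

/-- Sanity (definitional): `(C1)` with `X := η†` is `(C3)` up to `star_mulVec`/adjointness — recorded
as the trivial direction `EtaAnnihilatorConstraints → StaggeredOnsitePairZero` needs only
`⟨ψ, η†η ψ⟩ = ⟨ηψ, ηψ⟩`; we state the annihilation form which implies both at once. -/
theorem annihilated_gives_zero (L : ℕ) (ψ : Fock (Orb (FermionTorus 2 L)))
    (h : eta L *ᵥ ψ = 0) : star (eta L *ᵥ ψ) ⬝ᵥ (eta L *ᵥ ψ) = 0 := by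
  rw [h]; simp

end Summit.HubbardSuperconductivity.HubbardSuperconductivity.Cruxes.MesoscopicPairOrder.Ideator4

end
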